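import Literature.AlgebraicGeometry.Resolution.SecantColonAnnihilatorExistence
import Mathlib.RingTheory.Regular.RegularSequence
import HarnessLib

/-!
# `𝔯(M) = S` means every system of parameters is `M`-regular; off `V(𝔠)` modules are Cohen–Macaulay

Topic: `Literature/AlgebraicGeometry/Resolution` (the Cohen–Macaulay criterion behind
[Kawasaki2000, La. 2.4 (2)–(3)] / [Cesnavicius2021, (AR-b)]: "the ideal `𝔞_ℱ` cuts out a closed
subscheme whose open complement is `CM(ℱ)`", in the `Ext` form of `SecantColonAnnihilator*.lean`).

* `secantColonAnnihilator_eq_top_iff` — `𝔯(M) = S` iff every secant sequence `⊆ 𝔪` of `M` (every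
  part of a system of parameters) is weakly `M`-regular, i.e. `M` is Cohen–Macaulay in the strong
  "all systems of parameters" sense used by `KawasakiMacaulayfication`.
* `isWeaklyRegular_of_prod_annihilator_EMod_eq_top` — over a regular local ring `S`, if the
  `Ext`-annihilator ideal `𝔠 = ∏_{q ∈ (n-d, max n 2]} Ann E^q` of Theorem A is the unit ideal then
  every secant sequence `⊆ 𝔪` of `M` is weakly `M`-regular (the easy inclusion
  `non-CM locus ⊆ V(𝔠)` of [Cesnavicius2021, (AR-b)], via `𝔠 ⊆ 𝔯(M)`).
* `annihilator_EMod_eq_top_of_lt` — `E^q = 0` for `q > dim S` (Serre: `gl.dim S = dim S`), so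
  `prod_annihilator_EMod_eq_top_of_supportDim_eq_zero`: `𝔠 = S` for modules of dimension `0`
  (the generic points are off `V(𝔠)`).

[cite: Kawasaki2000, La. 2.4; Cesnavicius2021, §2 (AR-b); Schenzel1982, Satz 2.4.5]
-/

noncomputable section

open IsLocalRing Ideal Module RingTheory.Sequence

universe u v

namespace Literature.AlgebraicGeometry.Resolution

variable {S : Type u} [CommRing S]

/-! ## `𝔯(M) = S` iff all secant sequences are weakly regular -/

section Top

variable [IsLocalRing S] {M : Type v} [AddCommGroup M] [Module S M]

/-- **`𝔯(M) = S` iff every secant sequence `⊆ 𝔪` of `M` is weakly `M`-regular** (`1 ∈ 𝔯(M)` says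
exactly that the parameter colon modules `((r₁,…,rᵢ)M : rᵢ₊₁)/(r₁,…,rᵢ)M` all vanish).
[cite: Schenzel1982, Satz 2.4.5] -/
theorem secantColonAnnihilator_eq_top_iff :
    secantColonAnnihilator S M = ⊤ ↔
      ∀ rs : List S, IsSecantSequence M rs → (∀ r ∈ rs, r ∈ maximalIdeal S) →
        IsWeaklyRegular M rs := by
  constructor
  · intro h rs hrs hmem
    have h1 : (1 : S) ∈ secantColonAnnihilator S M := h ▸ Submodule.mem_top
    refine ⟨fun i hi => ?_⟩
    rw [isSMulRegular_iff_right_eq_zero_of_smul]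
    intro mbar hm
    induction mbar using Submodule.Quotient.induction_on with
    | H m =>
      rw [← Submodule.Quotient.mk_smul, Submodule.Quotient.mk_eq_zero] at hm
      rw [Submodule.Quotient.mk_eq_zero, ← one_smul S m]
      exact h1 hrs hmem hi hm
  · intro h
    refine eq_top_iff.mpr fun c _ rs hrs hmem i hi m hm => ?_
    have hreg := (h rs hrs hmem).regular_mod_prev i hi
    have hm0 : (Submodule.Quotient.mk m : M ⧸ (ofList (rs.take i) • ⊤ : Submodule S M)) = 0 :=
      hreg.right_eq_zero_of_smul (by rw [← Submodule.Quotient.mk_smul, Submodule.Quotient.mk_eq_zero]; exact hm)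
    rw [Submodule.Quotient.mk_eq_zero] at hm0
    exact Submodule.smul_mem _ c hm0

end Top

/-! ## Off `V(𝔠)` -/

section Regular

variable [IsRegularLocalRing S] {M : Type u} [AddCommGroup M] [Module S M] [Module.Finite S M]

/-- **Off `V(𝔠)` every system of parameters is `M`-regular**: if the `Ext`-annihilator ideal
`𝔠 = ∏_{q ∈ (n-d, max n 2]} Ann E^q(M)` is the unit ideal, then every secant sequence `⊆ 𝔪` of
`M` is weakly `M`-regular (`𝔠 ⊆ 𝔯(M)`, Theorem A). [cite: Cesnavicius2021, §2 (AR-b);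
Kawasaki2000, La. 2.4 (2)] -/
theorem isWeaklyRegular_of_prod_annihilator_EMod_eq_top [Nontrivial M] (F : FreeResolution S M)
    {n d : ℕ} (hn : ringKrullDim S = n) (hd : Module.supportDim S M = d)
    (htop : (∏ q ∈ Finset.Ioc (n - d) (max n 2), Module.annihilator S (F.EMod q)) = ⊤)
    {rs : List S} (hrs : IsSecantSequence M rs) (hmem : ∀ r ∈ rs, r ∈ maximalIdeal S) :
    IsWeaklyRegular M rs := by
  have h := prod_annihilator_EMod_le_secantColonAnnihilator F hn hd
  rw [htop, top_le_iff] at h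
  exact secantColonAnnihilator_eq_top_iff.mp h rs hrs hmem

/-- **`E^q(M) = 0` for `q > dim S`** over a regular local ring (every finite module has projective
dimension `≤ dim S`, [Matsumura1987, Thm. 19.2]; then the syzygy `K_{q-1}` is projective and
`B^q = K_q^*`). [cite: Matsumura1987, Thm. 19.2] -/
theorem annihilator_EMod_eq_top_of_lt (F : FreeResolution S M) {n : ℕ} (hn : ringKrullDim S = n)
    {q : ℕ} (hq : n < q) : Module.annihilator S (F.EMod q) = ⊤ := by
  obtain ⟨q', rfl⟩ : ∃ q', q = q' + 1 := ⟨q - 1, by omega⟩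
  obtain ⟨xs, hxreg, hxspan, hxlen⟩ := exists_isRegular_ofList_eq_maximalIdeal (R := S)
  have hpd := hasProjectiveDimensionLE_length_of_isWeaklyRegular hxreg.toIsWeaklyRegular hxspan
    (ModuleCat.of S M)
  rw [hn] at hxlen
  have hlen : xs.length = n := by exact_mod_cast hxlen
  haveI := F.projective_syzygyObj_of_hasProjectiveDimensionLE hpd q' (by omega)
  rw [Module.annihilator_eq_top_iff]
  exact Submodule.Quotient.subsingleton_iff.mpr (F.BSub_succ_eq_top q')

/-- **Modules of dimension `0` are off `V(𝔠)`**: for `dim M = 0` the range `(n, max n 2]` only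
contains `q > n = dim S`, where `E^q = 0`. [cite: Cesnavicius2021, §2 (AR-b)] -/
theorem prod_annihilator_EMod_eq_top_of_supportDim_eq_zero (F : FreeResolution S M) {n : ℕ}
    (hn : ringKrullDim S = n) :
    (∏ q ∈ Finset.Ioc (n - 0) (max n 2), Module.annihilator S (F.EMod q)) = ⊤ := by
  rw [Nat.sub_zero, ← Ideal.one_eq_top]
  refine Finset.prod_eq_one fun q hq => ?_
  rw [Finset.mem_Ioc] at hq
  rw [Ideal.one_eq_top]
  exact annihilator_EMod_eq_top_of_lt F hn hq.1

end Regular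

end Literature.AlgebraicGeometry.Resolution

end
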